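import Summits.BirchSwinnertonDyer.BirchSwinnertonDyer.Theorems.PrintCFramBottomClassIndexLawFiveLeEisensteinPairBernoulli
import Summits.BirchSwinnertonDyer.BirchSwinnertonDyer.Theorems.PrintCFramBottomClassIndexLawFiveLeBernoulliIntegralPrim
import Summits.BirchSwinnertonDyer.BirchSwinnertonDyer.Theorems.PrintCFramBottomClassIndexLawFiveLeKrizLiBindersAnchor11
import Summits.BirchSwinnertonDyer.BirchSwinnertonDyer.Theorems.PrintCFramBottomClassIndexLawFiveLeKrizLiBindersMember
import Summits.BirchSwinnertonDyer.BirchSwinnertonDyer.Theorems.PrintCFramBottomClassIndexLawFiveLeKrizLiBindersKroneckerEven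
import Mathlib.Tactic.NormNum.LegendreSymbol
import HarnessLib

/-!
# Crux `PrintCFram.BottomClassIndexLawFiveLe` (stmt-BirchSwinnertonDyer-20372), line `eisenstein-resource-bdp-line` (registry v10):
# THE LOCUS BOUNDARY IS A KERNEL STATEMENT — class 17424bl (`A(11)^{(3)}`, `p = 11`) has NO Kriz–Li datum over any `K''`
# (cell `bsd-print-cfram`, width seat `bsd-line-cfram-p1-w3` g3; THEOREMS ONLY, `--supports` 20372; BSD is not proved by any of this)

HONEST FRAMING. Nothing here is a statement about BSD; no stub of the skeleton is closed. Registry v10 (LEAD g7) composes the crux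
pointwise in the curve by `by_cases` on «a Kriz–Li datum exists» (`hKLd`: a Heegner field `K''`, character data `(f, ψ, ω, ε_K)` with
`hss`, (1), (3) and Kriz–Li Thm. 1.20's hypothesis (4)): ON the locus Stub H (print + classical cyclotomic theory), OFF the locus the
research pair (β1, pair-sum Kolyvagin). The w2 g4 census located the off-locus window classes NUMERICALLY (17424bl1@11, 305809c1@7:
class factor `p ∣ B_{1,ψ⁻¹}`). THIS FILE makes the first of them a THEOREM: for every `W` that is `ℚ`-isogenous to a curve
`ℚ`-isomorphic to `A(11)^{(3)}` (Cremona 17424bl) and EVERY imaginary quadratic `K''`, level `f`, primitive `ψ`, Teichmüller `ω`,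
Kronecker `ε_K`: the conjunction `hss ∧ … ∧ (4)` is FALSE (`not_exists_krizLiDatum_twist_three_cm11`). So the off-locus stubs of v10
are needed at 17424bl — the research residue of the line is provably non-empty, by name.

Mechanism (all ingredients are kernel theorems of the w3 thread): (i) the explicit class character `ψ₀ = χ₁₂·ω³` (level `132`) has
`hss` for `W` (w3 g2 `KrizLiBinders.krizLiBinders_of_coprime_twist_even`); (ii) UNIQUENESS OF THE EISENSTEIN PAIR (w3 g3
`EisensteinPair.bernoulliOnePrim_prod_eq_of_traceForm_congr`): any `ψ` with `hss` has the same Bernoulli product as `ψ₀`; (iii) the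
CLASS FACTOR `‖B_{1,ψ₀⁻¹}‖₁₁ = ‖B_{1,χ₁₂ω⁷}‖₁₁ ≤ 11⁻¹` by a kernel certificate (`certSum_132`: `11² ∣ Σ_{j<132} [j odd](3/j)·t(j mod 11)·j`,
`t(j) ≡ j^{77} (mod 11²)` = w3 g2's `teichmullerPowTable_11_7`; two numerical engines of w2 g4 agree: `v₁₁ = 1`); (iv) the `K''`-FACTOR
`B_{1,ψ₀ε_Kω⁻¹}` is `11`-integral for EVERY `K''` by w3 g3's `BernoulliIntegral.krizLi_bernoulli_hypothesis_fails_of_classFactor_of_unit`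
fed with the unit `u ≡ 7 (12), ≡ 1 (11), ≡ 1 (|d_K|)` (CRT, `d_K` odd), at which `(ψ₀ε_Kω⁻¹)(u) = χ₁₂(7) = −1 ≠ 1`.
No Heegner hypothesis, no `L`-value, no parity of `ε_K` is used. beyond-print theorem: NO.

References: [KrizLi2019] Thm. 1.20 (pp. 7–8), §7.1 (p. 43); [Washington1997] Thm. 4.2, §5.1; [Cox2013] §1.C Lemma 1.14
(the character of `ℚ(√3)`); Cremona tables (class 17424bl = `121b` twisted by `3`).
-/

set_option autoImplicit false
set_option linter.dupNamespace false

noncomputable section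

open scoped Classical

namespace Summit.BirchSwinnertonDyer.BirchSwinnertonDyer.Theorems.PrintCFram.OffLocus

open scoped NumberTheorySymbols
open WeierstrassCurve DirichletCharacter Literature.NumberTheory.LFunctions Literature.NumberTheory.EllipticCurves
  Literature.NumberTheory.EllipticCurves.ModularForms Literature.NumberTheory.EllipticCurves.Rank1Residual
  Literature.NumberTheory.EllipticCurves.KrizLi2019
  Summit.BirchSwinnertonDyer.Rank1Residual Summit.BirchSwinnertonDyer.Rank1Residual.X12.O11
  Summit.BirchSwinnertonDyer.BirchSwinnertonDyer.Theorems.PrintCFram.BernoulliIntegral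
  Summit.BirchSwinnertonDyer.BirchSwinnertonDyer.Theorems.PrintCFram.EisensteinPair

/-! ## §1 A certificate for a NON-UNIT Bernoulli number and the value formula of `χ↑·(ω^k)↑` -/

section Cert

variable {p : ℕ} [hp : Fact p.Prime]

/-- **Certificate for `‖B_{1,χ}‖_p ≤ p⁻¹` at a level with `ord_p n = 1`.** If `χ ≠ 1`, `χ(j) ≡ c(j)·j^e (mod p²)` for an integer
table `c`, and `p² ∣ S = Σ_j c(j)·j^{e+1}`, then `B_{1,χ} = (1/n)Σ χ(j) j` has `‖B_{1,χ}‖_p ≤ p⁻¹` (the non-unit companion of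
`RouteU.norm_generalizedBernoulli_one_eq_one_of_cert`). [cite: Washington1997, Thm. 4.2 and §5.1] [cite: KrizLi2019, §1.5 display (1) (p. 7)] -/
theorem norm_generalizedBernoulli_one_le_inv_of_cert {n : ℕ} [NeZero n]
    (χ : DirichletCharacter ℚ_[p] n) (hχ : χ ≠ 1) (hn : padicValNat p n = 1)
    (c : ZMod n → ℤ) (e : ℕ)
    (happrox : ∀ j : ZMod n, ‖χ j - (c j : ℚ_[p]) * (j.val : ℚ_[p]) ^ e‖ ≤ (p : ℝ) ^ (-2 : ℤ))
    (h2 : (p : ℤ) ^ 2 ∣ ∑ j : ZMod n, c j * (j.val : ℤ) ^ (e + 1)) :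
    ‖generalizedBernoulli 1 χ‖ ≤ (p : ℝ)⁻¹ := by
  have hp0 : (0 : ℝ) < (p : ℝ) := by exact_mod_cast hp.out.pos
  set S : ℤ := ∑ j : ZMod n, c j * (j.val : ℤ) ^ (e + 1) with hS
  set T : ℚ_[p] := ∑ j : ZMod n, χ j * (j.val : ℚ_[p]) with hT
  have hTS : ‖T - (S : ℚ_[p])‖ ≤ (p : ℝ) ^ (-2 : ℤ) := by
    have hdiff : T - (S : ℚ_[p]) =
        ∑ j : ZMod n, (χ j - (c j : ℚ_[p]) * (j.val : ℚ_[p]) ^ e) * (j.val : ℚ_[p]) := by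
      rw [hT, hS]; push_cast
      rw [← Finset.sum_sub_distrib]
      exact Finset.sum_congr rfl fun j _ => by ring
    rw [hdiff]
    refine IsUltrametricDist.norm_sum_le_of_forall_le_of_nonneg (zpow_nonneg (Nat.cast_nonneg p) _)
      fun j _ => ?_
    rw [norm_mul]
    calc ‖χ j - (c j : ℚ_[p]) * (j.val : ℚ_[p]) ^ e‖ * ‖(j.val : ℚ_[p])‖
        ≤ (p : ℝ) ^ (-2 : ℤ) * 1 :=
          mul_le_mul (happrox j) (by exact_mod_cast Padic.norm_int_le_one (j.val : ℤ)) (norm_nonneg _)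
            (zpow_nonneg (Nat.cast_nonneg p) _)
      _ = (p : ℝ) ^ (-2 : ℤ) := mul_one _
  have hSn : ‖(S : ℚ_[p])‖ ≤ (p : ℝ) ^ (-2 : ℤ) := by
    have := (Padic.norm_int_le_pow_iff_dvd S 2).mpr (by exact_mod_cast h2)
    exact_mod_cast this
  have hTn : ‖T‖ ≤ (p : ℝ) ^ (-2 : ℤ) := by
    have e1 : T = (T - (S : ℚ_[p])) + (S : ℚ_[p]) := by ring
    rw [e1]
    exact (IsUltrametricDist.norm_add_le_max _ _).trans (max_le hTS hSn)
  rw [generalizedBernoulli_one_eq_sum_div χ hχ, ← hT, norm_div,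
    RouteU.norm_natCast_eq_inv_of_padicValNat_eq_one hn, div_le_iff₀ (inv_pos.mpr hp0)]
  calc ‖T‖ ≤ (p : ℝ) ^ (-2 : ℤ) := hTn
    _ = (p : ℝ)⁻¹ * (p : ℝ)⁻¹ := by rw [zpow_neg, zpow_two, mul_inv]

/-- **Value formula.** For `χ` mod `m` and `θ` mod `p` with `m` coprime to `p`: `(χ↑·θ↑)(j) = χ(j mod m)·θ(j mod p)` at EVERY
residue `j` mod `p·m` (both sides vanish at non-units). [folklore] -/
theorem changeLevel_mul_apply_eq {m : ℕ} [NeZero m] (χ : DirichletCharacter ℚ_[p] m)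
    (θ : DirichletCharacter ℚ_[p] p) (j : ZMod (p * m)) :
    (changeLevel (dvd_mul_left m p) χ * changeLevel (dvd_mul_right p m) θ) j =
      χ (j.val : ZMod m) * θ (j.val : ZMod p) := by
  haveI : NeZero (p * m) := ⟨Nat.mul_ne_zero hp.out.ne_zero (NeZero.ne m)⟩
  by_cases hu : IsUnit j
  · have hcop : (j.val).Coprime (p * m) := (ZMod.isUnit_iff_coprime j.val (p * m)).mp (by
      rw [ZMod.natCast_zmod_val]; exact hu)
    have hcopZ : IsCoprime ((j.val : ℕ) : ℤ) ((p * m : ℕ) : ℤ) := Nat.isCoprime_iff_coprime.mpr hcop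
    have e1 := changeLevel_eq_cast_of_dvd' χ (dvd_mul_left m p) hcopZ
    have e2 := changeLevel_eq_cast_of_dvd' θ (dvd_mul_right p m) hcopZ
    simp only [Int.cast_natCast, ZMod.natCast_zmod_val] at e1 e2
    rw [MulChar.mul_apply, e1, e2]
  · rw [MulChar.map_nonunit _ hu]
    have hncop : ¬ (j.val).Coprime (p * m) := fun h => hu (by
      rw [← ZMod.natCast_zmod_val j]; exact (ZMod.isUnit_iff_coprime j.val (p * m)).mpr h)
    by_cases hjp : (j.val).Coprime p
    · have hjm : ¬ (j.val).Coprime m := fun h => hncop (Nat.Coprime.mul_right hjp h)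
      have : ¬ IsUnit ((j.val : ℕ) : ZMod m) := fun h => hjm ((ZMod.isUnit_iff_coprime j.val m).mp h)
      rw [MulChar.map_nonunit _ this, zero_mul]
    · have : ¬ IsUnit ((j.val : ℕ) : ZMod p) := fun h => hjp ((ZMod.isUnit_iff_coprime j.val p).mp h)
      rw [MulChar.map_nonunit _ this, mul_zero]

end Cert

/-! ## §2 The class factor of `A(11)^{(3)}` (class 17424bl): `‖B_{1,χ₁₂·ω⁷}‖₁₁ ≤ 11⁻¹` -/

/-- The values `[a odd]·(3/a)` of the Kronecker character of `ℚ(√3)` (conductor `12`) as a table on `a mod 12`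
(periodicity `jacobiSym.mod_right`; `(3/1) = (3/11) = 1`, `(3/5) = (3/7) = −1`). [cite: Cox2013, §1.C Lemma 1.14] -/
theorem kroneckerFour_three_eq_ite (a : ℕ) :
    ((if Even a then (0 : ℤ) else J(3 | a)) : ℤ) =
      if a % 12 = 1 ∨ a % 12 = 11 then 1 else if a % 12 = 5 ∨ a % 12 = 7 then -1 else 0 := by
  by_cases ha : Even a
  · rw [if_pos ha]
    obtain ⟨r, hr⟩ := ha
    have h1 : ¬ (a % 12 = 1 ∨ a % 12 = 11) := by omega
    have h2 : ¬ (a % 12 = 5 ∨ a % 12 = 7) := by omega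
    rw [if_neg h1, if_neg h2]
  · rw [if_neg ha]
    have hodd : Odd a := Nat.not_even_iff_odd.mp ha
    rw [jacobiSym.mod_right (3 : ℤ) hodd]
    have h12 : (4 * (3 : ℤ).natAbs) = 12 := by decide
    rw [h12]
    have hlt : a % 12 < 12 := Nat.mod_lt _ (by norm_num)
    have hodd' : a % 2 = 1 := Nat.odd_iff.mp hodd
    have hcases : a % 12 = 1 ∨ a % 12 = 3 ∨ a % 12 = 5 ∨ a % 12 = 7 ∨ a % 12 = 9 ∨ a % 12 = 11 := by omega
    rcases hcases with h | h | h | h | h | h <;> rw [h] <;> norm_num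

/-- **The certificate sum for `B_{1,χ₁₂ω⁷}`**: `S = Σ_{j mod 132} [j odd](3/j)·t(j mod 11)·j` with `t(j) ≡ j^{77} (mod 11²)`
(table `KrizLiBinders.teichmullerPowTable_11_7`) satisfies `11² ∣ S` — checked by the kernel (`S ≡ 0 (mod 121)`, and in fact
`S ≡ 968 (mod 1331)`, two engines of w2 g4's census: `v₁₁(B_{1,χ₁₂ω⁷}) = 1`). [folklore] -/
theorem certSum_132 :
    ((11 : ℕ) : ℤ) ^ 2 ∣ ∑ j : ZMod (11 * 12),
      ((if j.val % 12 = 1 ∨ j.val % 12 = 11 then (1 : ℤ) else if j.val % 12 = 5 ∨ j.val % 12 = 7 then -1 else 0) *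
        (((
    [0, 1, 40, 9, 27, 3, 118, 94, 112, 81, 120] : List ℕ).getD (j.val % 11) 0 : ℕ) : ℤ)) * (j.val : ℤ) ^ (0 + 1) := by
  decide +kernel

/-- `ord_{11}(11·12) = 1`. [folklore] -/
theorem padicValNat_11_mul_12 : padicValNat 11 (11 * 12) = 1 := by
  haveI : Fact (Nat.Prime 11) := ⟨by norm_num⟩
  rw [padicValNat.mul (by norm_num) (by norm_num), padicValNat_self, padicValNat.eq_zero_of_not_dvd (by norm_num)]

set_option maxRecDepth 40000 in
/-- **THE CLASS FACTOR OF 17424bl IS A NON-UNIT: `‖B_{1,χ₁₂·ω⁷}‖₁₁ ≤ 11⁻¹`.** For every Teichmüller `ω` mod `11` and every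
`ℚ₁₁`-valued `χ` mod `12` with the Kronecker values `[a odd]·(3/a)` of `ℚ(√3)`: the character `χ↑·(ω⁷)↑` mod `132` — which is
`ψ⁻¹` for the class character `ψ = χ₁₂·ω³` of `A(11)^{(3)}` (w2 g4 census: `17424bl1`, `d = 3`, `ψ = χ₃ω³`) — has a NON-UNIT
first Bernoulli number. This is the «class factor `p ∣ B_{1,ψ⁻¹}`» flagging the level-1 cell `17424bl1@11`.
[cite: KrizLi2019, Thm. 1.20 (p. 8, hypothesis (4))] [cite: Washington1997, Thm. 4.2 and §5.1] -/
theorem norm_generalizedBernoulli_classFactor_132_le [Fact (Nat.Prime 11)]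
    (ω : DirichletCharacter ℚ_[11] 11) (hω : IsTeichmullerCharacter ω)
    (χ : DirichletCharacter ℚ_[11] 12) (hχ : ∀ a : ℕ, χ (a : ZMod 12) = ((if Even a then (0 : ℤ) else J(3 | a) : ℤ) : ℚ_[11])) :
    ‖generalizedBernoulli 1 (changeLevel (dvd_mul_left 12 11) χ * changeLevel (dvd_mul_right 11 12) (ω ^ 7) :
        DirichletCharacter ℚ_[11] (11 * 12))‖ ≤ (11 : ℝ)⁻¹ := by
  set θ : DirichletCharacter ℚ_[11] (11 * 12) :=
    changeLevel (dvd_mul_left 12 11) χ * changeLevel (dvd_mul_right 11 12) (ω ^ 7) with hθdef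
  have hval : ∀ j : ZMod (11 * 12), θ j = χ (j.val : ZMod 12) * ω (j.val : ZMod 11) ^ 7 := by
    intro j
    rw [hθdef, changeLevel_mul_apply_eq (p := 11) χ (ω ^ 7) j, MulChar.pow_apply' _ (by norm_num)]
  -- `θ ≠ 1`: `θ(5) = χ(5)·ω(5)^7` with `χ(5) = −1`, so `θ(5) ≠ 1` (else `ω(5)^7 = −1`, `‖ω(5)^7 + 1‖ = 0 < …` contradicts rigidity? simpler: norms)
  have hθ1 : θ ≠ 1 := by
    intro h
    have h5' := hval ((5 : ℕ) : ZMod (11 * 12))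
    have hv' : (((5 : ℕ) : ZMod (11 * 12))).val = 5 := by rw [ZMod.val_natCast]
    have hu' : IsUnit (((5 : ℕ) : ZMod (11 * 12))) := (ZMod.isUnit_iff_coprime 5 (11 * 12)).mpr (by norm_num)
    rw [h, MulChar.one_apply hu', hv', hχ 5] at h5'
    have hj : ((if Even 5 then (0 : ℤ) else J(3 | 5) : ℤ) : ℚ_[11]) = -1 := by
      rw [kroneckerFour_three_eq_ite 5]; norm_num
    rw [hj] at h5'
    -- `1 = -1 * ω(5)^7` ⟹ `ω(5)^7 = -1` ⟹ `(ω(5)^7)^10 = 1` but also `= (-1)^10 = 1`: no contradiction this way; use norms mod 11: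
    -- `ω(5) ≡ 5 (mod 11)` ⟹ `ω(5)^7 ≡ 5^7 = 78125 ≡ 3 (mod 11)` ⟹ `-ω(5)^7 ≡ -3 ≢ 1`.
    have ht := AnchorReduction.norm_teichmuller_pow_sub_table_le ω hω (k := 7) (by norm_num) (fun j => (
    [0, 1, 40, 9, 27, 3, 118, 94, 112, 81, 120] : List ℕ).getD j 0) rfl KrizLiBinders.teichmullerPowTable_11_7
      ((5 : ℕ) : ZMod 11)
    have hv5 : (((5 : ℕ) : ZMod 11)).val = 5 := by rw [ZMod.val_natCast]
    rw [hv5] at ht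
    simp only [List.getD_cons_succ, List.getD_cons_zero] at ht
    -- `ω(5)^7 = -1` from `h5'`
    have hw : ω ((5 : ℕ) : ZMod 11) ^ 7 = -1 := by linear_combination h5'
    rw [hw] at ht
    -- `‖-1 - 3‖ = ‖-4‖ = 1 > 11⁻²`
    have hn : ‖(-1 : ℚ_[11]) - ((3 : ℕ) : ℚ_[11])‖ = 1 := by
      rw [show (-1 : ℚ_[11]) - ((3 : ℕ) : ℚ_[11]) = ((-4 : ℤ) : ℚ_[11]) by push_cast; ring]
      exact Padic.norm_intCast_eq_one_iff.mpr (by norm_num)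
    rw [hn] at ht
    norm_num at ht
  refine norm_generalizedBernoulli_one_le_inv_of_cert θ hθ1 padicValNat_11_mul_12
    (fun j => (if j.val % 12 = 1 ∨ j.val % 12 = 11 then (1 : ℤ) else if j.val % 12 = 5 ∨ j.val % 12 = 7 then -1 else 0) *
      (((
    [0, 1, 40, 9, 27, 3, 118, 94, 112, 81, 120] : List ℕ).getD (j.val % 11) 0 : ℕ) : ℤ)) 0 (fun j => ?_) certSum_132
  rw [pow_zero, mul_one, hval j, hχ j.val, kroneckerFour_three_eq_ite]
  have hv : (j.val : ZMod 11).val = j.val % 11 := ZMod.val_natCast _ _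
  have htab := AnchorReduction.norm_teichmuller_pow_sub_table_le ω hω (k := 7) (by norm_num) (fun j => (
    [0, 1, 40, 9, 27, 3, 118, 94, 112, 81, 120] : List ℕ).getD j 0) rfl KrizLiBinders.teichmullerPowTable_11_7
    (j.val : ZMod 11)
  rw [hv] at htab
  set cj : ℤ := (if j.val % 12 = 1 ∨ j.val % 12 = 11 then (1 : ℤ) else if j.val % 12 = 5 ∨ j.val % 12 = 7 then -1 else 0)
    with hcj
  have hL : ‖(cj : ℚ_[11])‖ ≤ 1 := Padic.norm_int_le_one _
  have hsplit : (cj : ℚ_[11]) * ω (j.val : ZMod 11) ^ 7 -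
      ((cj * (((
    [0, 1, 40, 9, 27, 3, 118, 94, 112, 81, 120] : List ℕ).getD (j.val % 11) 0 : ℕ) : ℤ) : ℤ) : ℚ_[11]) =
      (cj : ℚ_[11]) * (ω (j.val : ZMod 11) ^ 7 - (((
    [0, 1, 40, 9, 27, 3, 118, 94, 112, 81, 120] : List ℕ).getD (j.val % 11) 0 : ℕ) : ℚ_[11])) := by
    push_cast; ring
  rw [hsplit, norm_mul]
  calc ‖(cj : ℚ_[11])‖ * _ ≤ 1 * (11 : ℝ) ^ (-2 : ℤ) := mul_le_mul hL htab (norm_nonneg _) zero_le_one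
    _ = ((11 : ℕ) : ℝ) ^ (-2 : ℤ) := by rw [one_mul]; norm_num


/-! ## §3 17424bl has NO Kriz–Li datum over any imaginary quadratic field -/

/-- CRT input: for odd `d`, `gcd(12, 11·d) ∣ 6`, so `7 ≡ 1 (mod gcd(12, 11·d))`. [folklore] -/
theorem seven_modEq_one_gcd (d : ℕ) (hd : Odd d) : 7 ≡ 1 [MOD Nat.gcd 12 (11 * d)] := by
  set g := Nat.gcd 12 (11 * d) with hg
  have hg12 : g ∣ 12 := Nat.gcd_dvd_left _ _
  have hgd : g ∣ 11 * d := Nat.gcd_dvd_right _ _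
  have hgo : Odd g := (Odd.mul (by decide : Odd 11) hd).of_dvd_nat hgd
  have hg3 : g ∣ 3 := by
    have h4 : Nat.Coprime g 4 := by
      rw [show (4 : ℕ) = 2 ^ 2 by norm_num]
      exact Nat.Coprime.pow_right 2 hgo.coprime_two_right
    exact h4.dvd_of_dvd_mul_left (show g ∣ 4 * 3 by simpa using hg12)
  exact ((Nat.modEq_iff_dvd' (by norm_num)).mpr (dvd_trans hg3 (by norm_num))).symm

/-- **A unit `u` of `ℤ/(132·d·11)` with `u ≡ 7 (mod 12)`, `u ≡ 1 (mod 11)`, `u ≡ 1 (mod d)`** (`d` odd). [folklore] -/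
theorem exists_unit_seven_one_one (d : ℕ) [NeZero d] (hd : Odd d) :
    ∃ n₀ : ℕ, n₀.Coprime (11 * 12 * d * 11) ∧ (n₀ : ZMod 12) = ((7 : ℕ) : ZMod 12) ∧ (n₀ : ZMod 11) = 1 ∧
      (n₀ : ZMod d) = 1 := by
  obtain ⟨n₀, h7, h1⟩ := Nat.chineseRemainder' (seven_modEq_one_gcd d hd)
  have h11 : n₀ ≡ 1 [MOD 11] := h1.of_mul_right d
  have hdd : n₀ ≡ 1 [MOD d] := h1.of_mul_left 11
  refine ⟨n₀, ?_, ?_, ?_, ?_⟩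
  · have c12 : n₀.Coprime 12 := by
      have : Nat.gcd n₀ 12 = Nat.gcd 7 12 := Nat.ModEq.gcd_eq h7
      rw [Nat.Coprime, this]; decide
    have c11 : n₀.Coprime 11 := by
      have : Nat.gcd n₀ 11 = Nat.gcd 1 11 := Nat.ModEq.gcd_eq h11
      rw [Nat.Coprime, this, Nat.gcd_one_left]
    have cd : n₀.Coprime d := by
      have : Nat.gcd n₀ d = Nat.gcd 1 d := Nat.ModEq.gcd_eq hdd
      rw [Nat.Coprime, this, Nat.gcd_one_left]
    exact Nat.Coprime.mul_right (Nat.Coprime.mul_right (Nat.Coprime.mul_right c11 c12) cd) c11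
  · exact (ZMod.natCast_eq_natCast_iff' n₀ 7 12).mpr h7
  · rw [(ZMod.natCast_eq_natCast_iff' n₀ 1 11).mpr h11, Nat.cast_one]
  · rw [(ZMod.natCast_eq_natCast_iff' n₀ 1 d).mpr hdd, Nat.cast_one]

set_option maxRecDepth 40000 in
/-- **17424bl HAS NO KRIZ–LI DATUM (the locus boundary of v10 is a kernel statement at `p = 11`).** Let `W/ℚ` be any elliptic
curve `ℚ`-isogenous to a curve `ℚ`-isomorphic to the quadratic twist `A(11)^{(3)}` (Cremona class `17424bl`, the census cell
`17424bl1@11` of LEAD g6's «no-Kriz–Li-datum locus»). Then there are NO data `(K'', f, ψ, ω, ε_K, …)` as in the `hKLd` branch of the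
line's composition at `p = 11`: for EVERY imaginary quadratic field `K''`, every level `f`, every primitive `ψ`, every Teichmüller
`ω`, every Kronecker character `ε_K` of `K''`, the trace form `hss` forces `ψ ∈ {χ₁₂ω³, χ₁₂ω⁸}` up to lift (uniqueness of the
Eisenstein pair), the pair `{B_{1,ψ₀⁻¹ε_K}, B_{1,ψ₀ω⁻¹}}` is then `{B_{1,χ₁₂ω⁷}, B_{1,χ₁₂ε_Kω²}}` whose class factor is a NON-UNIT
(`certSum_132`) and whose `K''`-factor is `11`-integral (a unit `u ≡ 7 (12), ≡ 1 (11·|d_K|)` has `(χ₁₂ε_Kω²)(u) = −1`), so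
hypothesis (4) FAILS. Hence on this ℚ-isogeny class the crux's v10 composition is in its OFF-LOCUS branch (β1 + pair-sum Kolyvagin):
the research residue of registry v10 is provably non-empty. (No Heegner, parity or `L`-value hypothesis is used.)
[cite: KrizLi2019, Thm. 1.20 (pp. 7–8, hypothesis (4)), §7.1 (p. 43)] [cite: Washington1997, §5.1, Thm. 4.2] -/
theorem not_exists_krizLiDatum_twist_three_cm11 [Fact (Nat.Prime 11)] (W W₁ : WeierstrassCurve ℚ) [W.IsElliptic]
    [W₁.IsElliptic] (hiso : IsIsogenous W W₁) (hW₁ : ∃ C : VariableChange ℚ, C • W₁ = cm11.quadraticTwist ((3 : ℤ) : ℚ)) :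
    ¬ ∃ (N : ℕ) (_ : NeZero N) (K : Type) (_ : Field K) (_ : NumberField K) (Dt : ModularParametrizationData W N)
          (H : HeegnerDatum N (NumberField.discr K)) (ι : K →+* ℂ) (P : (W.baseChange K).toAffine.Point)
          (f : ℕ) (_ : NeZero f) (ψ : DirichletCharacter ℚ_[11] f) (ω : DirichletCharacter ℚ_[11] 11)
          (εK : DirichletCharacter ℚ_[11] (NumberField.discr K).natAbs),
          W.conductorNorm ℤ = N ∧ IsImaginaryQuadratic K ∧ SatisfiesHeegnerHypothesis N K ∧ Odd (NumberField.discr K) ∧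
          NumberField.discr K < -4 ∧ (W.quadraticTwist (NumberField.discr K : ℚ)).entireLFunction 1 ≠ 0 ∧
          WeierstrassCurve.Affine.Point.map ι.toRatAlgHom P = heegnerPointComplex Dt H ∧
          ψ.IsPrimitive ∧ IsTeichmullerCharacter ω ∧
          (∀ ℓ : ℕ, ℓ.Prime → ¬ (ℓ ∣ 11 * W.conductorNorm ℤ) →
            ‖((W.LFunction ℓ : ℤ) : ℚ_[11]) - (ψ (ℓ : ZMod f) + ψ⁻¹ (ℓ : ZMod f) * ω (ℓ : ZMod 11))‖ < 1) ∧
          ψ (11 : ZMod f) ≠ 1 ∧ primVal (invMulOmega ψ ω) 11 ≠ 1 ∧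
          (∀ ℓ : ℕ, (hℓ : ℓ.Prime) → ℓ ≠ 11 →
            (haveI := Fact.mk hℓ; ¬ W.HasGoodReductionAtPrime ℓ ∧ ¬ W.HasMultiplicativeReductionAtPrime ℓ) →
            ψ (ℓ : ZMod f) ≠ 1 ∧ primVal (invMulOmega ψ ω) ℓ ≠ 1) ∧
          IsKroneckerCharacterOf K εK ∧
          ¬ (‖bernoulliOnePrim (bernoulliCharOne ψ εK) *
              bernoulliOnePrim (bernoulliCharTwo ψ εK ω)‖ ≤ (11 : ℝ)⁻¹) := by
  rintro ⟨N, _, K, _, _, _Dt, _H, _ι, _P, f, hf, ψ, ω, εK, _hN, _hK, _hHN, hodd, _hd4, _hLt, -, _hψ, hω, hss, -, -, -, _hεK,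
    h4⟩
  apply h4
  have h11 : (11 : ℕ) ≠ 2 := by norm_num
  -- the discriminant level
  have hd0 : (NumberField.discr K).natAbs ≠ 0 := Int.natAbs_ne_zero.mpr (NumberField.discr_ne_zero K)
  haveI : NeZero (NumberField.discr K).natAbs := ⟨hd0⟩
  have hdodd : Odd (NumberField.discr K).natAbs := Int.natAbs_odd.mpr hodd
  -- the class character data `χ₁₂`, `ψ_can = χ₁₂↑·(ω³)↑` at level `11·12`
  obtain ⟨χ, hχ⟩ := KrizLiBinders.exists_kroneckerFourPadic (p := 11) (3 : ℤ) (by norm_num) (k := 4 * (3 : ℤ).natAbs) rfl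
  haveI : NeZero (4 * (3 : ℤ).natAbs) := ⟨by decide⟩
  obtain ⟨_, hss₀, -, -⟩ := KrizLiBinders.krizLiBinders_of_coprime_twist_even (p := 11) h11 cm11 (k := 3) (by norm_num)
    (by norm_num) (fun q _ hq => EisensteinTraceForm.hasGoodReductionAtPrime_cm11 q hq)
    (fun ℓ _ hℓ => by simpa using EisensteinTraceForm.lFunction_cm11_mod ℓ hℓ) W W₁ hiso (e := 3) (Or.inr (by norm_num))
    (by norm_num) (by norm_num) hW₁ χ hχ ω hω
  -- abbreviate the class character
  set ψ₀ : DirichletCharacter ℚ_[11] (11 * (4 * (3 : ℤ).natAbs)) :=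
    changeLevel (dvd_mul_left (4 * (3 : ℤ).natAbs) 11) χ * changeLevel (dvd_mul_right 11 (4 * (3 : ℤ).natAbs)) (ω ^ 3)
    with hψ₀
  -- (4) is intrinsic: transfer from `ψ` to `ψ₀` (uniqueness of the Eisenstein pair)
  refine krizLi_hypothesis_four_fails_of_hss (by norm_num) W ψ₀ ψ ω hω εK hss₀ hss ?_
  -- `ψ₀` is odd: `χ(−1) = χ(11) = (3/11) = 1`, `k = 3` odd
  have hχ11 : χ (-1) = 1 := by
    have e : ((11 : ℕ) : ZMod (4 * (3 : ℤ).natAbs)) = -1 := by decide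
    rw [← e, hχ 11, kroneckerFour_three_eq_ite 11]; norm_num
  have hψ₀odd : ψ₀.Odd := by
    rw [hψ₀]
    exact KrizLiBinders.psi_odd_of ω χ 3 h11 hω (by norm_num) (by rw [hχ11]; norm_num)
  have hψ₀ne : ¬ ψ₀.Even := not_even_of_odd' ψ₀ hψ₀odd
  -- the class factor `‖B_{1,ψ₀⁻¹}‖ ≤ 11⁻¹`
  have hcls : ‖bernoulliOnePrim ψ₀⁻¹‖ ≤ (11 : ℝ)⁻¹ := by
    have hχq : χ⁻¹ = χ := by
      have hq := KrizLiBinders.isQuadratic_of_forall_eq_kroneckerFour hχ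
      exact MulChar.IsQuadratic.inv hq
    have hinv : ψ₀⁻¹ = changeLevel (dvd_mul_left (4 * (3 : ℤ).natAbs) 11) χ *
        changeLevel (dvd_mul_right 11 (4 * (3 : ℤ).natAbs)) (ω ^ 7) := by
      rw [hψ₀, mul_inv, ← map_inv, ← map_inv, hχq, KrizLiBinders.char_pow_inv_eq ω (by norm_num)]
    have hprim : (changeLevel (dvd_mul_left (4 * (3 : ℤ).natAbs) 11) χ *
        changeLevel (dvd_mul_right 11 (4 * (3 : ℤ).natAbs)) (ω ^ 7) : DirichletCharacter ℚ_[11] (11 * (4 * (3 : ℤ).natAbs))).IsPrimitive :=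
      KrizLiBinders.psi_isPrimitive ω χ 7 (by norm_num)
        (KrizLiBinders.isPrimitive_of_forall_eq_kroneckerFour' rfl (Or.inr (by norm_num)) (by norm_num) hχ)
        (KrizLiBinders.teichmuller_pow_ne_one hω (by norm_num) (by norm_num))
    rw [hinv, RouteU.bernoulliOnePrim_eq_of_isPrimitive _ hprim]
    exact norm_generalizedBernoulli_classFactor_132_le ω hω χ hχ
  -- the unit
  obtain ⟨n₀, hcop, h12, h11', hdK⟩ := exists_unit_seven_one_one (NumberField.discr K).natAbs hdodd
  have hcop' : n₀.Coprime (11 * (4 * (3 : ℤ).natAbs) * (NumberField.discr K).natAbs * 11) := hcop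
  set u : (ZMod (11 * (4 * (3 : ℤ).natAbs) * (NumberField.discr K).natAbs * 11))ˣ := ZMod.unitOfCoprime n₀ hcop' with hu
  have huval : (u : ZMod (11 * (4 * (3 : ℤ).natAbs) * (NumberField.discr K).natAbs * 11)) = n₀ :=
    ZMod.coe_unitOfCoprime n₀ hcop'
  refine krizLi_bernoulli_hypothesis_fails_of_classFactor_of_unit h11 ψ₀ εK ω hψ₀ne hcls u ?_ ?_
  · -- `u ≡ 1 (mod 11)`
    rw [huval, ZMod.val_natCast]
    have hmod : n₀ % (11 * (4 * (3 : ℤ).natAbs) * (NumberField.discr K).natAbs * 11) ≡ n₀ [MOD 11] :=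
      (Nat.mod_modEq n₀ _).of_dvd (Dvd.intro_left _ rfl)
    rw [(ZMod.natCast_eq_natCast_iff' _ _ 11).mpr hmod, h11']
  · -- the value of `ψ₀ω⁻¹ε_K` at `u` is `−1`
    have hcopZ : IsCoprime (n₀ : ℤ) ((11 * (4 * (3 : ℤ).natAbs) * (NumberField.discr K).natAbs * 11 : ℕ) : ℤ) :=
      Nat.isCoprime_iff_coprime.mpr hcop'
    have hcopZ' : IsCoprime (n₀ : ℤ) ((11 * (4 * (3 : ℤ).natAbs) * (NumberField.discr K).natAbs : ℕ) : ℤ) :=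
      Nat.isCoprime_iff_coprime.mpr (Nat.Coprime.coprime_dvd_right (Dvd.intro 11 rfl) hcop')
    have hcopZ'' : IsCoprime (n₀ : ℤ) ((11 * (4 * (3 : ℤ).natAbs) : ℕ) : ℤ) :=
      Nat.isCoprime_iff_coprime.mpr (Nat.Coprime.coprime_dvd_right (Dvd.intro ((NumberField.discr K).natAbs * 11) (by ring)) hcop')
    have en : (u : ZMod (11 * (4 * (3 : ℤ).natAbs) * (NumberField.discr K).natAbs * 11)) = ((n₀ : ℤ) : ZMod _) := by
      rw [huval, Int.cast_natCast]
    rw [en, RegularLocusBernoulliPair.bernoulliCharTwo_of_not_even ψ₀ εK ω hψ₀ne, MulChar.mul_apply,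
      changeLevel_eq_cast_of_dvd' _ _ hcopZ, changeLevel_eq_cast_of_dvd' _ _ hcopZ, MulChar.mul_apply,
      changeLevel_eq_cast_of_dvd' _ _ hcopZ', changeLevel_eq_cast_of_dvd' _ _ hcopZ', hψ₀, MulChar.mul_apply,
      changeLevel_eq_cast_of_dvd' _ _ hcopZ'', changeLevel_eq_cast_of_dvd' _ _ hcopZ'']
    have h12' : ((n₀ : ℕ) : ZMod (4 * (3 : ℤ).natAbs)) = ((7 : ℕ) : ZMod (4 * (3 : ℤ).natAbs)) := h12
    have hχn : χ (((n₀ : ℕ) : ℤ) : ZMod (4 * (3 : ℤ).natAbs)) = -1 := by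
      rw [Int.cast_natCast, h12', hχ 7, kroneckerFour_three_eq_ite 7]
      norm_num
    have hωn : (ω ^ 3) (((n₀ : ℕ) : ℤ) : ZMod 11) = 1 := by rw [Int.cast_natCast, h11', map_one]
    have hωn' : ω⁻¹ (((n₀ : ℕ) : ℤ) : ZMod 11) = 1 := by rw [Int.cast_natCast, h11', map_one]
    have hεn : εK (((n₀ : ℕ) : ℤ) : ZMod (NumberField.discr K).natAbs) = 1 := by rw [Int.cast_natCast, hdK, map_one]
    rw [hχn, hωn, hωn', hεn]
    norm_num

end Summit.BirchSwinnertonDyer.BirchSwinnertonDyer.Theorems.PrintCFram.OffLocus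

end
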